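import Summits.AtomisticToContinuum.HydrodynamicLimit.Theorems.JParityClosureLocalSecondLawContactCondLaw
import Summits.AtomisticToContinuum.HydrodynamicLimit.Theorems.JParityClosureLocalSecondLawInitialLayerLLN

/-!
# Stub B′ (`stub_initialMatching`) of the line `contact-asymmetry-information` for the crux `LocalSecondLaw`
(stmt-AtomisticToContinuum-13081) — part 4: tilt transfer of dominated observables and the flow-free three-field LLN

Two inputs of the fields half of B′ for the momentum and the kinetic energy:
* `contactB_norm_integral_sub_le_of_dom` — transfer of a DOMINATED (possibly unbounded, vector-valued) observable to a
  bounded tilt: if `‖F‖ ≤ H`, `E_μ[H²] ≤ K`, `‖F − c‖ ≤ ε` off `B` and `μ S ≥ δ″`, then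
  `‖E_{μ(·|S)}F − c‖ ≤ ε + (K/L + (L + ‖c‖) μ B)/δ″` for every truncation level `L > 0` (pointwise
  `H𝟙_B ≤ H²/L + L𝟙_B`; no Hölder);
* `contactB_fields_uniformLLN` — the fixed-`r`, uniform-in-`x` weak LLN for the three cone fields `(ρ_r, m_r, e_r)` of
  the CONFIGURATION (flow-free: `Φ₀ = id` a.s., `localGibbsLaw_preimage_flow_zero`) against the SMEARED data
  `∫ b_r ρ(0)`, `∫ b_r ρ(0)u(0)`, `∫ b_r E(0)` (finite net `gridUp_euclidNet`, centre-Lipschitz cone fields with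
  energy-tight constants `initL_fields_lip`, Lipschitz smeared data `contactB_smear_lip_vec`; no `r → 0`);
plus the `s = 0` identities `m̄(0,x) = E_ν[m_r]`, `ē(0,x) = E_ν[e_r]` for conditioned local Gibbs laws
(`contactB_momBar_zero`, `contactB_kinBar_zero`).

References: H. Spohn, *Large Scale Dynamics of Interacting Particles* (1991), Part I §2.3–§3; C. Kipnis, C. Landim,
*Scaling Limits of Interacting Particle Systems* (1999), Ch. 4.
-/

noncomputable section

open scoped BigOperators Topology Classical MeasureTheory ENNReal InnerProductSpace
open Filter Set MeasureTheory Function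
open Literature.MathematicalPhysics.KineticTheory
open Literature.Analysis.FluidPDE
open Summit.AtomisticToContinuum.HydrodynamicLimit.Theorems.LocalSecondLawNegative
open Summit.AtomisticToContinuum.HydrodynamicLimit.Theorems.LocalSecondLawLedger

namespace Summit.AtomisticToContinuum.HydrodynamicLimit.Theorems.LocalSecondLawContact

/-- **Transfer of a DOMINATED (possibly unbounded) observable to a bounded tilt** (the conditioning step of B′ for the
momentum / kinetic-energy fields): if `|F| ≤ H` with `E_μ[H²] ≤ K`, `|F − c| ≤ ε` off `B`, and `μ S ≥ δ″ > 0`, then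
`|E_{μ(·|S)} F − c| ≤ ε + (K/L + (L + |c|) μ(B)) / δ″` for every truncation level `L > 0`
(pointwise `H·𝟙_B ≤ H²/L + L·𝟙_B`; no Hölder). -/
theorem contactB_norm_integral_sub_le_of_dom :
    ∀ {E : Type*} [NormedAddCommGroup E] [NormedSpace ℝ E] [CompleteSpace E] {N : ℕ} (μ : Measure (Phase N))
      [IsProbabilityMeasure μ] (S B : Set (Phase N)) (F : Phase N → E) (H : Phase N → ℝ) (c : E)
      (ε K L δ'' : ℝ), MeasurableSet B → AEStronglyMeasurable F μ → Measurable H → (∀ z, ‖F z‖ ≤ H z) →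
      ∫⁻ z, ENNReal.ofReal (H z ^ 2) ∂μ ≤ ENNReal.ofReal K → 0 ≤ K → 0 < L → 0 ≤ ε → 0 < δ'' →
      ENNReal.ofReal δ'' ≤ μ S → (∀ z, z ∉ B → ‖F z - c‖ ≤ ε) →
      ‖(∫ z, F z ∂(condLaw μ S)) - c‖ ≤ ε + (K / L + (L + ‖c‖) * (μ B).toReal) / δ'' := by
  intro E _ _ _ N μ _ S B F H c ε K L δ'' hBm hFm hHm hFH hK hK0 hL hε hδ hS hoff
  have hH0 : ∀ z, 0 ≤ H z := fun z => (norm_nonneg _).trans (hFH z)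
  have hS0 : μ S ≠ 0 := (lt_of_lt_of_le (ENNReal.ofReal_pos.2 hδ) hS).ne'
  have hStop : μ S ≠ ⊤ := measure_ne_top μ S
  set ν : Measure (Phase N) := condLaw μ S
  haveI : IsProbabilityMeasure ν := contactB_condLaw_isProbability_of_floor μ S δ'' hδ hS
  -- integrability of `H²`, `H`, `F` under `μ` and `ν`
  have hH2i : Integrable (fun z => H z ^ 2) μ := by
    refine ⟨(hHm.pow_const 2).aestronglyMeasurable, ?_⟩
    rw [hasFiniteIntegral_iff_ofReal (Eventually.of_forall fun z => by positivity)]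
    exact lt_of_le_of_lt hK ENNReal.ofReal_lt_top
  have hHi : Integrable H μ := by
    have hmaj : Integrable (fun z => 1 + H z ^ 2) μ := (integrable_const (1 : ℝ)).add hH2i
    refine hmaj.mono' hHm.aestronglyMeasurable (Eventually.of_forall fun z => ?_)
    rw [Real.norm_eq_abs, abs_of_nonneg (hH0 z)]
    nlinarith [sq_nonneg (H z - 1), hH0 z]
  have hνle : ν ≤ (μ S)⁻¹ • μ := contactB_condLaw_le_smul μ S
  have hint_ν : ∀ {g : Phase N → ℝ}, Integrable g μ → Integrable g ν := fun hg =>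
    (hg.smul_measure (ENNReal.inv_ne_top.2 hS0)).mono_measure hνle
  have hFiμ : Integrable F μ := hHi.mono' hFm (Eventually.of_forall fun z => hFH z)
  have hFi : Integrable F ν := (hFiμ.smul_measure (ENNReal.inv_ne_top.2 hS0)).mono_measure hνle
  -- pointwise bound
  have hpt : ∀ z, ‖F z - c‖ ≤ ε + H z ^ 2 / L + (L + ‖c‖) * B.indicator (fun _ => (1 : ℝ)) z := by
    intro z
    by_cases hz : z ∈ B
    · rw [Set.indicator_of_mem hz, mul_one]
      have h1 : ‖F z - c‖ ≤ H z + ‖c‖ := (norm_sub_le _ _).trans (add_le_add (hFH z) le_rfl)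
      have h2 : H z ≤ H z ^ 2 / L + L := by
        rw [div_add' _ _ _ hL.ne', le_div_iff₀ hL]
        nlinarith [sq_nonneg (H z - L)]
      have h3 : 0 ≤ H z ^ 2 / L := by positivity
      linarith
    · rw [Set.indicator_of_notMem hz, mul_zero, add_zero]
      have h3 : 0 ≤ H z ^ 2 / L := by positivity
      linarith [hoff z hz]
  -- integrate under `ν`
  have hgi : Integrable (fun z => ε + H z ^ 2 / L + (L + ‖c‖) * B.indicator (fun _ => (1 : ℝ)) z) ν :=
    ((integrable_const ε).add ((hint_ν hH2i).div_const L)).add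
      (((integrable_const (1 : ℝ)).indicator hBm).const_mul _)
  have hsub : (∫ z, F z ∂ν) - c = ∫ z, (F z - c) ∂ν := by
    rw [integral_sub hFi (integrable_const c), integral_const, probReal_univ, one_smul]
  have step1 : ‖(∫ z, F z ∂ν) - c‖ ≤ ε + (∫ z, H z ^ 2 ∂ν) / L + (L + ‖c‖) * (ν B).toReal := by
    rw [hsub]
    calc ‖∫ z, (F z - c) ∂ν‖ ≤ ∫ z, ‖F z - c‖ ∂ν := norm_integral_le_integral_norm _
      _ ≤ ∫ z, (ε + H z ^ 2 / L + (L + ‖c‖) * B.indicator (fun _ => (1 : ℝ)) z) ∂ν :=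
          integral_mono (hFi.sub (integrable_const c)).norm hgi hpt
      _ = ε + (∫ z, H z ^ 2 ∂ν) / L + (L + ‖c‖) * (ν B).toReal := by
          have i3 : Integrable (fun z => H z ^ 2 / L) ν := (hint_ν hH2i).div_const L
          have i1 : Integrable (fun z => ε + H z ^ 2 / L) ν := (integrable_const ε).add i3
          have i2 : Integrable (fun z => (L + ‖c‖) * B.indicator (fun _ => (1 : ℝ)) z) ν :=
            ((integrable_const (1 : ℝ)).indicator hBm).const_mul _
          rw [integral_add i1 i2, integral_add (integrable_const ε) i3, integral_const, probReal_univ, one_smul,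
            integral_div, integral_const_mul, integral_indicator_const _ hBm, smul_eq_mul, mul_one, Measure.real]
  -- the two conditioned quantities against `μ` and the floor
  have hinv : ((μ S)⁻¹).toReal ≤ δ''⁻¹ := by
    have h1 : (μ S)⁻¹ ≤ (ENNReal.ofReal δ'')⁻¹ := ENNReal.inv_le_inv.2 hS
    rw [ENNReal.ofReal_inv_of_pos hδ |>.symm] at h1
    exact ENNReal.toReal_le_of_le_ofReal (by positivity) h1
  have hH2ν : ∫ z, H z ^ 2 ∂ν ≤ K / δ'' := by
    have h1 := contactB_condLaw_integral_le μ S (fun z => H z ^ 2) (fun z => by positivity) hH2i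
    have h2 : ∫ z, H z ^ 2 ∂μ ≤ K := by
      have h3 := ofReal_integral_eq_lintegral_ofReal hH2i (Eventually.of_forall fun z => by positivity)
      rw [← ENNReal.ofReal_le_ofReal_iff hK0, h3]
      exact hK
    have h4 : 0 ≤ ∫ z, H z ^ 2 ∂μ := integral_nonneg fun z => by positivity
    calc ∫ z, H z ^ 2 ∂ν ≤ ((μ S)⁻¹).toReal * ∫ z, H z ^ 2 ∂μ := h1
      _ ≤ δ''⁻¹ * K := mul_le_mul hinv h2 h4 (by positivity)
      _ = K / δ'' := by rw [inv_mul_eq_div]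
  have hνB : (ν B).toReal ≤ (μ B).toReal / δ'' := by
    have h1 : ν B ≤ (μ S)⁻¹ * μ B := contactB_condLaw_apply_le μ S B
    have h2 : (ν B).toReal ≤ ((μ S)⁻¹).toReal * (μ B).toReal := by
      rw [← ENNReal.toReal_mul]
      exact ENNReal.toReal_mono (ENNReal.mul_ne_top (ENNReal.inv_ne_top.2 hS0) (measure_ne_top μ B)) h1
    calc (ν B).toReal ≤ ((μ S)⁻¹).toReal * (μ B).toReal := h2
      _ ≤ δ''⁻¹ * (μ B).toReal := mul_le_mul_of_nonneg_right hinv ENNReal.toReal_nonneg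
      _ = (μ B).toReal / δ'' := by rw [inv_mul_eq_div]
  have hLc : 0 ≤ L + ‖c‖ := by positivity
  calc ‖(∫ z, F z ∂ν) - c‖ ≤ ε + (∫ z, H z ^ 2 ∂ν) / L + (L + ‖c‖) * (ν B).toReal := step1
    _ ≤ ε + (K / δ'') / L + (L + ‖c‖) * ((μ B).toReal / δ'') := by
        gcongr
    _ = ε + (K / L + (L + ‖c‖) * (μ B).toReal) / δ'' := by
        field_simp
        ring

/-- Vector-valued smeared data are `3/(πr⁴)·R`-Lipschitz in the centre for continuous `g` with `‖g‖ ≤ R`. -/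
theorem contactB_smear_lip_vec :
    ∀ {E : Type*} [NormedAddCommGroup E] [NormedSpace ℝ E] [CompleteSpace E] {r R : ℝ}, 0 < r →
      ∀ (g : T3 → E), Continuous g → (∀ y, ‖g y‖ ≤ R) → ∀ x x' : T3,
      ‖(∫ y, cone r y x • g y) - ∫ y, cone r y x' • g y‖ ≤ 3 / (Real.pi * r ^ 4) * Torus.euclidDist x x' * R := by
  intro E _ _ _ r R hr g hgc hg x x'
  have hR : 0 ≤ R := (norm_nonneg _).trans (hg 0)
  have hi : ∀ x₀ : T3, Integrable (fun y => cone r y x₀ • g y) := fun x₀ =>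
    integrable_of_continuous_T3 ((contactB_continuous_cone_left r x₀).smul hgc)
  rw [← integral_sub (hi x) (hi x')]
  have hd0 : 0 ≤ Torus.euclidDist x x' := norm_nonneg _
  have hpt : ∀ y, ‖cone r y x • g y - cone r y x' • g y‖ ≤ 3 / (Real.pi * r ^ 4) * Torus.euclidDist x x' * R := by
    intro y
    rw [← sub_smul, norm_smul, Real.norm_eq_abs]
    refine mul_le_mul ?_ (hg y) (norm_nonneg _) (by positivity)
    rw [show cone r y x = cone r x y from densMod_cone_comm r x y,
      show cone r y x' = cone r x' y from densMod_cone_comm r x' y]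
    exact gridUp_abs_cone_sub_cone_le hr x x' y
  have h := norm_integral_le_of_norm_le_const (μ := (volume : Measure T3)) (Eventually.of_forall hpt)
  rwa [probReal_univ, mul_one] at h

/-- Smeared vector data of a continuous `g` with `‖g‖ ≤ R` are bounded by `3/(πr³)·R`. -/
theorem contactB_smear_bound_vec :
    ∀ {E : Type*} [NormedAddCommGroup E] [NormedSpace ℝ E] [CompleteSpace E] {r R : ℝ}, 0 < r →
      ∀ (g : T3 → E), (∀ y, ‖g y‖ ≤ R) → ∀ x : T3, ‖∫ y, cone r y x • g y‖ ≤ 3 / (Real.pi * r ^ 3) * R := by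
  intro E _ _ _ r R hr g hg x
  have hR : 0 ≤ R := (norm_nonneg _).trans (hg 0)
  have hpt : ∀ y, ‖cone r y x • g y‖ ≤ 3 / (Real.pi * r ^ 3) * R := by
    intro y
    rw [norm_smul, Real.norm_eq_abs, abs_of_nonneg (cone_nonneg hr y x)]
    exact mul_le_mul (contactB_cone_le_const hr y x) (hg y) (norm_nonneg _) (by positivity)
  have h := norm_integral_le_of_norm_le_const (μ := (volume : Measure T3)) (Eventually.of_forall hpt)
  rwa [probReal_univ, mul_one] at h

/-- At `s = 0` the mean coarse momentum of a conditioned local Gibbs law is the plain expectation of `m_r` (no flow). -/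
theorem contactB_momBar_zero :
    ∀ {N : ℕ} (σ r : ℝ) (a₀ θ₀ : T3 → ℝ) (u₀ : T3 → V3) (Φ : Flow σ N) (S : Set (Phase N)) (x : T3),
      momBar r (condLaw (localGibbsLaw σ a₀ u₀ θ₀ N Φ) S) Φ 0 x =
        ∫ z, momC r z x ∂(condLaw (localGibbsLaw σ a₀ u₀ θ₀ N Φ) S) := by
  intro N σ r a₀ θ₀ u₀ Φ S x
  unfold momBar
  refine integral_congr_ae ?_
  filter_upwards [contactB_flow_zero_ae_condLaw σ a₀ θ₀ u₀ Φ S] with z hz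
  rw [hz]

/-- At `s = 0` the mean coarse kinetic energy of a conditioned local Gibbs law is the plain expectation of `e_r`. -/
theorem contactB_kinBar_zero :
    ∀ {N : ℕ} (σ r : ℝ) (a₀ θ₀ : T3 → ℝ) (u₀ : T3 → V3) (Φ : Flow σ N) (S : Set (Phase N)) (x : T3),
      kinBar r (condLaw (localGibbsLaw σ a₀ u₀ θ₀ N Φ) S) Φ 0 x =
        ∫ z, kinC r z x ∂(condLaw (localGibbsLaw σ a₀ u₀ θ₀ N Φ) S) := by
  intro N σ r a₀ θ₀ u₀ Φ S x
  unfold kinBar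
  refine integral_congr_ae ?_
  filter_upwards [contactB_flow_zero_ae_condLaw σ a₀ θ₀ u₀ Φ S] with z hz
  rw [hz]

/-- **Fixed-`r` uniform-in-`x` LLN for the three cone fields of the CONFIGURATION (flow-free) against the smeared
data**, under the `t = 0` tie with continuous data: eventually in `N`, off an event of law-mass `≤ δ`, at every centre
`ρ_r, m_r, e_r` are `ε`-close to `∫ b_r ρ(0)`, `∫ b_r ρ(0)u(0)`, `∫ b_r E(0)` (finite net; centre-Lipschitz cone
fields with energy-tight constants `initL_fields_lip`; `Φ₀ = id` a.s. transfers the tie to the configuration,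
`localGibbsLaw_preimage_flow_zero`). -/
theorem contactB_fields_uniformLLN :
    ∀ {σ : ℝ} {a₀ θ₀ : T3 → ℝ} {u₀ : T3 → V3} {ρ θ : ℝ → T3 → ℝ} {u : ℝ → T3 → V3},
      Continuous (ρ 0) → Continuous (u 0) → Continuous (θ 0) →
      ∀ Φ : (N : ℕ) → Flow σ N, TendstoHydroFieldsAt (fun N => localGibbsLaw σ a₀ u₀ θ₀ N (Φ N)) Φ ρ u θ 0 →
      ∀ {r ε δ : ℝ}, 0 < r → 0 < ε → 0 < δ → ∃ N₀ : ℕ, ∀ N : ℕ, N₀ ≤ N →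
        ∃ B : Set (Phase N), localGibbsLaw σ a₀ u₀ θ₀ N (Φ N) B ≤ ENNReal.ofReal δ ∧
          ∀ z, z ∉ B → ∀ x : T3,
            |rhoC r z x - ∫ y, cone r y x * ρ 0 y| < ε ∧
            ‖momC r z x - ∫ y, (cone r y x * ρ 0 y) • u 0 y‖ < ε ∧
            |kinC r z x - ∫ y, cone r y x * totalEnergyDensity (ρ 0 y) (u 0 y) (θ 0 y)| < ε := by
  intro σ a₀ θ₀ u₀ ρ θ u hρc huc hθc Φ h0 r ε δ hr hε hδ
  have hEc : Continuous fun x => totalEnergyDensity (ρ 0 x) (u 0 x) (θ 0 x) := by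
    unfold totalEnergyDensity; fun_prop
  have hMc : Continuous fun x => ρ 0 x • u 0 x := hρc.smul huc
  obtain ⟨R₁, -, hR₁⟩ := exists_forall_abs_le_of_continuous hρc
  obtain ⟨R₂, hR₂0, hR₂⟩ := exists_forall_abs_le_of_continuous (continuous_norm.comp hMc)
  obtain ⟨R₃, -, hR₃⟩ := exists_forall_abs_le_of_continuous hEc
  set R : ℝ := |R₁| + |R₂| + |R₃| + 1
  have hR1 : ∀ y, |ρ 0 y| ≤ R := fun y => (hR₁ y).trans (by
    have := le_abs_self R₁; have := abs_nonneg R₂; have := abs_nonneg R₃; linarith)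
  have hR2 : ∀ y, ‖ρ 0 y • u 0 y‖ ≤ R := fun y => by
    have h := hR₂ y
    rw [Function.comp_apply, abs_of_nonneg (norm_nonneg _)] at h
    have := le_abs_self R₂; have := abs_nonneg R₁; have := abs_nonneg R₃; linarith
  have hR3 : ∀ y, |totalEnergyDensity (ρ 0 y) (u 0 y) (θ 0 y)| ≤ R := fun y => (hR₃ y).trans (by
    have := le_abs_self R₃; have := abs_nonneg R₁; have := abs_nonneg R₂; linarith)
  have hε4 : 0 < ε / 4 := by positivity
  -- constants at fixed `r`, mesh, net
  set L : ℝ := 3 / (Real.pi * r ^ 4)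
  have hLpos : 0 < L := by positivity
  set IE : ℝ := ∫ x, (1 : ℝ) * totalEnergyDensity (ρ 0 x) (u 0 x) (θ 0 x)
  set K : ℝ := |IE| + 1 with hK
  have hK1 : 1 ≤ K := by have := abs_nonneg IE; linarith
  have hRpos : 0 < R := by
    show 0 < |R₁| + |R₂| + |R₃| + 1
    positivity
  have hKR : 0 < 1 + K + R := by linarith
  have hL'pos : 0 < L * (1 + K + R) := mul_pos hLpos hKR
  set m : ℝ := ε / (4 * (L * (1 + K + R)))
  have hmpos : 0 < m := by positivity
  have hmL : L * (1 + K + R) * m = ε / 4 := by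
    show L * (1 + K + R) * (ε / (4 * (L * (1 + K + R)))) = ε / 4
    field_simp
  obtain ⟨Sx, hSx⟩ := gridUp_euclidNet hmpos
  -- the bad events (flow-free)
  set P : (N : ℕ) → Measure (Phase N) := fun N => localGibbsLaw σ a₀ u₀ θ₀ N (Φ N)
  set A1 : (N : ℕ) → T3 → Set (Phase N) := fun N y =>
    {w | ε / 4 < |empiricalDensityField w (fun x => cone r x y) - ∫ x, cone r x y * ρ 0 x|}
  set A2 : (N : ℕ) → T3 → Set (Phase N) := fun N y =>
    {w | ε / 4 < ‖empiricalMomentumField w (fun x => cone r x y) - ∫ x, (cone r x y * ρ 0 x) • u 0 x‖}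
  set A3 : (N : ℕ) → T3 → Set (Phase N) := fun N y =>
    {w | ε / 4 < |empiricalEnergyField w (fun x => cone r x y) -
      ∫ x, cone r x y * totalEnergyDensity (ρ 0 x) (u 0 x) (θ 0 x)|}
  set AE : (N : ℕ) → Set (Phase N) := fun N => {w | 1 < |empiricalEnergyField w (fun _ => 1) - IE|}
  have hpre : ∀ (N : ℕ) (A : Set (Phase N)), P N ((Φ N).flow 0 ⁻¹' A) = P N A := fun N A => by
    show localGibbsLaw σ a₀ u₀ θ₀ N (Φ N) ((Φ N).flow 0 ⁻¹' A) = localGibbsLaw σ a₀ u₀ θ₀ N (Φ N) A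
    rw [localGibbsLaw_preimage_flow_zero, localGibbsLaw_eq]
  have hA : ∀ y : T3, Tendsto (fun N => P N (A1 N y) + P N (A2 N y) + P N (A3 N y)) atTop (𝓝 0) := by
    intro y
    obtain ⟨h1, h2, h3⟩ := h0 (fun x => cone r x y) (densMod_continuous_cone r y) (ε / 4) hε4
    have h := (h1.add h2).add h3
    rw [add_zero, add_zero] at h
    refine h.congr fun N => ?_
    show P N ((Φ N).flow 0 ⁻¹' A1 N y) + P N ((Φ N).flow 0 ⁻¹' A2 N y) + P N ((Φ N).flow 0 ⁻¹' A3 N y) = _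
    rw [hpre, hpre, hpre]
  have hAE' : Tendsto (fun N => P N (AE N)) atTop (𝓝 0) := by
    refine ((h0 (fun _ => (1 : ℝ)) continuous_const 1 one_pos).2.2).congr fun N => ?_
    show P N ((Φ N).flow 0 ⁻¹' AE N) = _
    rw [hpre]
  set f : ℕ → ENNReal := fun N => (∑ y ∈ Sx, (P N (A1 N y) + P N (A2 N y) + P N (A3 N y))) + P N (AE N)
  have hfT : Tendsto f atTop (𝓝 0) := by
    have hsum := tendsto_finsetSum Sx fun y (_ : y ∈ Sx) => hA y
    rw [Finset.sum_const_zero] at hsum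
    simpa only [add_zero] using hsum.add hAE'
  obtain ⟨N₀, hN₀⟩ := eventually_atTop.1 ((tendsto_order.1 hfT).2 _ (ENNReal.ofReal_pos.2 hδ))
  refine ⟨N₀, fun N hN => ⟨(⋃ y ∈ Sx, (A1 N y ∪ A2 N y ∪ A3 N y)) ∪ AE N, ?_, ?_⟩⟩
  · calc P N ((⋃ y ∈ Sx, (A1 N y ∪ A2 N y ∪ A3 N y)) ∪ AE N)
        ≤ P N (⋃ y ∈ Sx, (A1 N y ∪ A2 N y ∪ A3 N y)) + P N (AE N) := measure_union_le _ _
      _ ≤ (∑ y ∈ Sx, P N (A1 N y ∪ A2 N y ∪ A3 N y)) + P N (AE N) :=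
          add_le_add (measure_biUnion_finset_le Sx _) le_rfl
      _ ≤ f N := by
          refine add_le_add (Finset.sum_le_sum fun y _ => ?_) le_rfl
          exact (measure_union_le _ _).trans (add_le_add (measure_union_le _ _) le_rfl)
      _ ≤ ENNReal.ofReal δ := (hN₀ N hN).le
  · intro w hz x
    have memU : ∀ y ∈ Sx, ∀ {S : T3 → Set (Phase N)}, w ∈ S y → w ∈ ⋃ y ∈ Sx, S y :=
      fun y hy S h => Set.mem_iUnion.2 ⟨y, Set.mem_iUnion.2 ⟨hy, h⟩⟩
    obtain ⟨y, hy, hxy⟩ := hSx x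
    -- energy bound off `AE`
    have hEn : empiricalEnergyField w (fun _ => 1) ≤ K := by
      have h1 : ¬ (1 < |empiricalEnergyField w (fun _ => 1) - IE|) := fun h => hz (Or.inr h)
      have h2 := le_abs_self (empiricalEnergyField w (fun _ => 1) - IE)
      have h3 := le_abs_self IE
      rw [hK]; linarith [not_lt.1 h1]
    have hE0 := initL_energy_nonneg w
    -- the LLN at the net point `y`
    have e1 : |rhoC r w y - ∫ x, cone r x y * ρ 0 x| ≤ ε / 4 :=
      not_lt.1 fun h => hz (Or.inl (memU y hy (S := fun y => A1 N y ∪ A2 N y ∪ A3 N y) (Or.inl (Or.inl h))))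
    have e2 : ‖momC r w y - ∫ x, (cone r x y * ρ 0 x) • u 0 x‖ ≤ ε / 4 :=
      not_lt.1 fun h => hz (Or.inl (memU y hy (S := fun y => A1 N y ∪ A2 N y ∪ A3 N y) (Or.inl (Or.inr h))))
    have e3 : |kinC r w y - ∫ x, cone r x y * totalEnergyDensity (ρ 0 x) (u 0 x) (θ 0 x)| ≤ ε / 4 :=
      not_lt.1 fun h => hz (Or.inl (memU y hy (S := fun y => A1 N y ∪ A2 N y ∪ A3 N y) (Or.inr h)))
    -- Lipschitz from `x` to the net point (fields)
    obtain ⟨l1, l2, l3⟩ := initL_fields_lip hr w x y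
    have hd0 : 0 ≤ Torus.euclidDist x y := norm_nonneg _
    have hLd0 : 0 ≤ L * Torus.euclidDist x y := mul_nonneg hLpos.le hd0
    have hLd : L * Torus.euclidDist x y * (1 + K + R) ≤ ε / 4 := by
      have h1 : L * Torus.euclidDist x y ≤ L * m := mul_le_mul_of_nonneg_left hxy hLpos.le
      calc L * Torus.euclidDist x y * (1 + K + R) ≤ L * m * (1 + K + R) :=
            mul_le_mul_of_nonneg_right h1 hKR.le
        _ = ε / 4 := by rw [← hmL]; ring
    have hfac : ∀ {a : ℝ}, 0 ≤ a → a ≤ 1 + K + R → L * Torus.euclidDist x y * a ≤ ε / 4 := fun ha hle =>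
      (mul_le_mul_of_nonneg_left hle hLd0).trans hLd
    have l1' : |rhoC r w x - rhoC r w y| ≤ ε / 4 := by
      refine l1.trans ?_
      have h := hfac zero_le_one (by linarith)
      rwa [mul_one] at h
    have l2' : ‖momC r w x - momC r w y‖ ≤ ε / 4 :=
      l2.trans (hfac (by linarith) (by linarith))
    have l3' : |kinC r w x - kinC r w y| ≤ ε / 4 :=
      l3.trans (hfac hE0 (by linarith))
    -- Lipschitz from the net point back to `x` (smeared data)
    have hback : 3 / (Real.pi * r ^ 4) * Torus.euclidDist y x * R ≤ ε / 4 := by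
      rw [Torus.euclidDist_comm]
      exact hfac hRpos.le (by linarith)
    have d1 : |(∫ x', cone r x' y * ρ 0 x') - ∫ x', cone r x' x * ρ 0 x'| ≤ ε / 4 := by
      have h := contactB_smear_lip_vec (E := ℝ) hr (ρ 0) hρc (fun y' => by
        rw [Real.norm_eq_abs]; exact hR1 y') y x
      simp only [smul_eq_mul, Real.norm_eq_abs] at h
      exact h.trans hback
    have d2 : ‖(∫ x', (cone r x' y * ρ 0 x') • u 0 x') - ∫ x', (cone r x' x * ρ 0 x') • u 0 x'‖ ≤ ε / 4 := by
      have h := contactB_smear_lip_vec hr (fun y' => ρ 0 y' • u 0 y') hMc hR2 y x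
      simp only [← mul_smul] at h
      exact h.trans hback
    have d3 : |(∫ x', cone r x' y * totalEnergyDensity (ρ 0 x') (u 0 x') (θ 0 x')) -
        ∫ x', cone r x' x * totalEnergyDensity (ρ 0 x') (u 0 x') (θ 0 x')| ≤ ε / 4 := by
      have h := contactB_smear_lip_vec (E := ℝ) hr (fun y' => totalEnergyDensity (ρ 0 y') (u 0 y') (θ 0 y')) hEc
        (fun y' => by rw [Real.norm_eq_abs]; exact hR3 y') y x
      simp only [smul_eq_mul, Real.norm_eq_abs] at h
      exact h.trans hback
    refine ⟨?_, ?_, ?_⟩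
    · have t1 := abs_sub_le (rhoC r w x) (rhoC r w y) (∫ x', cone r x' x * ρ 0 x')
      have t2 := abs_sub_le (rhoC r w y) (∫ x', cone r x' y * ρ 0 x') (∫ x', cone r x' x * ρ 0 x')
      linarith only [t1, t2, l1', e1, d1, hε]
    · have t1 := norm_sub_le_norm_sub_add_norm_sub (momC r w x) (momC r w y) (∫ x', (cone r x' x * ρ 0 x') • u 0 x')
      have t2 := norm_sub_le_norm_sub_add_norm_sub (momC r w y) (∫ x', (cone r x' y * ρ 0 x') • u 0 x')
        (∫ x', (cone r x' x * ρ 0 x') • u 0 x')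
      linarith only [t1, t2, l2', e2, d2, hε]
    · have t1 := abs_sub_le (kinC r w x) (kinC r w y)
        (∫ x', cone r x' x * totalEnergyDensity (ρ 0 x') (u 0 x') (θ 0 x'))
      have t2 := abs_sub_le (kinC r w y) (∫ x', cone r x' y * totalEnergyDensity (ρ 0 x') (u 0 x') (θ 0 x'))
        (∫ x', cone r x' x * totalEnergyDensity (ρ 0 x') (u 0 x') (θ 0 x'))
      linarith only [t1, t2, l3', e3, d3, hε]

end Summit.AtomisticToContinuum.HydrodynamicLimit.Theorems.LocalSecondLawContact

end
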